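import Summits.BirchSwinnertonDyer.BirchSwinnertonDyer.Theorems.KimAtThreeDeepLowerOffStratumLevelLoweringMultiStabPeriod
import HarnessLib

/-!
# Route `KimAtThreeKolyvagin` (rung W2), crux `DeepLowerAtThreeOffKatoStratum` (item 19679), registered
# stub `stub_nonAdditive`, ROAD (b^k) at ANY LEVEL: the CANONICAL-PERIOD NORMALISATION for the plus symbol of
# `G = Σᵢ cᵢ φᵢ` (real-coefficient cusp forms) WITHOUT the square-free level hypothesis, from one non-Eisenstein
# prime `r ≡ 1 (mod N)`

Cell `bsd-addord`, seat `bsd-addord-w2-acc2`, gen 7; item `stmt-BirchSwinnertonDyer-19679` (`--supports`, closes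
nothing). Gen 6's `…MultiStabPeriod.exists_period_integral_unit_cycle_sum_smul` produces the period `Ω` of
`Ψ = plusSymbol (Σ cᵢ φᵢ)` at SQUAREFREE level (cusp class of `a/c` = `gcd(c, N)`). THIS FILE removes «squarefree»:
at any level the class of `a/c` is Diamond–Shurman's invariant `(d, a·(c/d) mod gcd(d, N/d))`, `d = gcd(c, N)` (tree
`cuspInv`, `cuspOrbitOf_eq_iff_cuspInv_eq`), and for a prime `r ≡ 1 (mod N)` — the Chebotarev numeral `r₀` the chain
already uses (`…NonEisensteinPrime`) — the `r + 1` cusps `(x+j)/r`, `rx` of `T_r{∞, x}` have the SAME invariant as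
`x` (§1), so gen 6's boundary-killing step runs verbatim (§2). Period producer for the NON-SEMISTABLE rows of the
stub (level `N = M₀·D·q`, `M₀` non-squarefree). Theorems only; no definition, no fact; BSD is not proved by this.
References: Diamond–Shurman (2005) §3.8, Prop. 3.8.3 [DiamondShurman2005]; Cremona (1997) Prop. 2.2.3, §2.8
[CremonaAlgorithms1997]; Vatsal, Duke 98 (1999) §1 (1.3) (5), (1.5)–(1.6), Rem. (1.12) [Vatsal1999].
-/

set_option autoImplicit false
-- the Theorems namespace of a single-conjunct summit repeats the summit name by design (D-0017)
set_option linter.dupNamespace false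

noncomputable section

open scoped MatrixGroups ModularForm Classical NNReal

open CongruenceSubgroup WeierstrassCurve Literature.NumberTheory.EllipticCurves
  Literature.NumberTheory.EllipticCurves.ModularForms ModularGroup
open UpperHalfPlane hiding I

namespace Summit.BirchSwinnertonDyer.BirchSwinnertonDyer.Theorems.KimAtThreeDeepLowerOffStratumLevelLoweringMultiStabPeriodAnyLevel

open Summit.BirchSwinnertonDyer.BirchSwinnertonDyer.Theorems.KimAtThreeDeepLowerOffStratumLevelLoweringVatsal
open Summit.BirchSwinnertonDyer.BirchSwinnertonDyer.Theorems.KimAtThreeDeepLowerOffStratumLevelLoweringVatsalStabRows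
open Summit.BirchSwinnertonDyer.BirchSwinnertonDyer.Theorems.KimAtThreeDeepLowerOffStratumLevelLoweringCanonicalPeriod
open Summit.BirchSwinnertonDyer.BirchSwinnertonDyer.Theorems.KimAtThreeDeepLowerOffStratumLevelLoweringMultiStabPeriod
open Summit.BirchSwinnertonDyer.BirchSwinnertonDyer.Theorems.KimAtThreeDeepLowerOffStratumLevelLoweringStabEigenform
  (smul_plusSymbol_of_heckeT)

/-! ### §1 Cusp classes of `Γ₀(N)` at ANY level under the Hecke correspondence at `r ≡ 1 (mod N)` -/

section Cusps

variable {N : ℕ} [NeZero N]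

/-- **Column data preserving the cusp invariant.** If the first columns `(a, c)`, `(a', c')` of `k, k' ∈ SL₂(ℤ)`
satisfy `t a' = α a + β c`, `t c' = d c` with `α d ≡ 1`, `t² ≡ 1 (mod N)`, then the Diamond–Shurman invariants
`(gcd(c, N), a·(c/gcd) mod gcd(gcd, N/gcd))` of the cusps `a/c`, `a'/c'` agree: `gcd(c', N) = gcd(c, N)` as `t, d`
are prime to `N`, and `t²·a'(c'/g) = αd·a(c/g) + βd·c·(c/g) ≡ a(c/g)` modulo `gcd(g, N/g) ∣ g ∣ c`.
[cite: DiamondShurman2005, §3.8] [cite: CremonaAlgorithms1997, Prop. 2.2.3] -/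
theorem cuspInv_eq_of_column_data {k k' : SL(2, ℤ)} {t α β d : ℤ}
    (h0 : t * k' 0 0 = α * k 0 0 + β * k 1 0) (h1 : t * k' 1 0 = d * k 1 0)
    (hαd : (N : ℤ) ∣ α * d - 1) (ht : (N : ℤ) ∣ t * t - 1) :
    cuspInv N k' = cuspInv N k := by
  have htN : Nat.Coprime t.natAbs N := by
    obtain ⟨m, hm⟩ := ht
    have : IsCoprime t (N : ℤ) := ⟨t, -m, by linear_combination hm⟩
    simpa [Int.isCoprime_iff_gcd_eq_one, Int.gcd] using this
  have hdN : Nat.Coprime d.natAbs N := by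
    obtain ⟨m, hm⟩ := hαd
    have : IsCoprime d (N : ℤ) := ⟨α, -m, by linear_combination hm⟩
    simpa [Int.isCoprime_iff_gcd_eq_one, Int.gcd] using this
  have hD : cuspDivisor N k' = cuspDivisor N k := by
    rw [cuspDivisor, cuspDivisor, ← int_gcd_mul_left_of_coprime htN (k' 1 0), h1, int_gcd_mul_left_of_coprime hdN]
  rw [cuspInv, cuspInv, CuspIndex.mk_eq_mk_iff]
  refine ⟨hD, ?_⟩
  -- the unit component: `gcd(g, N/g) ∣ u' − u`
  set g : ℕ := cuspDivisor N k with hg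
  set G : ℕ := Nat.gcd g (N / g) with hG
  have hgc : (g : ℤ) ∣ k 1 0 := cuspDivisor_dvd_apply N k
  have hgc' : (g : ℤ) ∣ k' 1 0 := hD ▸ cuspDivisor_dvd_apply N k'
  have hGg : (G : ℤ) ∣ (g : ℤ) := Int.natCast_dvd_natCast.mpr (Nat.gcd_dvd_left _ _)
  have hGN : (G : ℤ) ∣ (N : ℤ) := hGg.trans (Int.natCast_dvd_natCast.mpr (cuspDivisor_dvd N k))
  rw [hD, ZMod.intCast_eq_intCast_iff_dvd_sub]
  change (G : ℤ) ∣ cuspUnitInt N k - cuspUnitInt N k'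
  rw [cuspUnitInt, cuspUnitInt, hD]
  obtain ⟨c₁, hc₁⟩ := hgc
  obtain ⟨c₁', hc₁'⟩ := hgc'
  have hg0 : (g : ℤ) ≠ 0 := by exact_mod_cast cuspDivisor_ne_zero N k
  have e1 : k 1 0 / (g : ℤ) = c₁ := by rw [hc₁, Int.mul_ediv_cancel_left _ hg0]
  have e1' : k' 1 0 / (g : ℤ) = c₁' := by rw [hc₁', Int.mul_ediv_cancel_left _ hg0]
  rw [← hg, e1, e1']
  have h1' : t * c₁' = d * c₁ := by
    have : (g : ℤ) * (t * c₁') = (g : ℤ) * (d * c₁) := by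
      calc (g : ℤ) * (t * c₁') = t * (g * c₁') := by ring
        _ = t * k' 1 0 := by rw [hc₁']
        _ = d * k 1 0 := h1
        _ = (g : ℤ) * (d * c₁) := by rw [hc₁]; ring
    exact mul_left_cancel₀ hg0 this
  have key : t * t * (k' 0 0 * c₁') = α * d * (k 0 0 * c₁) + β * d * c₁ * k 1 0 := by
    calc t * t * (k' 0 0 * c₁') = (t * k' 0 0) * (t * c₁') := by ring
      _ = (α * k 0 0 + β * k 1 0) * (d * c₁) := by rw [h0, h1']
      _ = α * d * (k 0 0 * c₁) + β * d * c₁ * k 1 0 := by ring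
  obtain ⟨m₁, hm₁⟩ := hαd
  obtain ⟨m₂, hm₂⟩ := ht
  obtain ⟨n₁, hn₁⟩ := hGN
  have hGc : (G : ℤ) ∣ k 1 0 := hGg.trans ⟨c₁, hc₁⟩
  obtain ⟨n₂, hn₂⟩ := hGc
  -- `u − u' = t² u' − u' − (t² u' − u)` with both pieces divisible by `G`
  have : k 0 0 * c₁ - k' 0 0 * c₁' =
      (G : ℤ) * (-(n₁ * m₁ * (k 0 0 * c₁)) - β * d * c₁ * n₂ + n₁ * m₂ * (k' 0 0 * c₁')) := by
    have e : (N : ℤ) = G * n₁ := hn₁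
    linear_combination (-1 : ℤ) * key - (k 0 0 * c₁) * hm₁ - (k 0 0 * c₁ * m₁) * e + (k' 0 0 * c₁') * hm₂ +
      (k' 0 0 * c₁' * m₂) * e - (β * d * c₁) * hn₂
  exact ⟨_, this⟩

/-- Hence the cusps `k∞`, `k'∞` are `Γ₀(N)`-equivalent. [cite: DiamondShurman2005, Prop. 3.8.3 and §3.8] -/
theorem cuspOrbitOf_eq_of_column_data {k k' : SL(2, ℤ)} {t α β d : ℤ}
    (h0 : t * k' 0 0 = α * k 0 0 + β * k 1 0) (h1 : t * k' 1 0 = d * k 1 0)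
    (hαd : (N : ℤ) ∣ α * d - 1) (ht : (N : ℤ) ∣ t * t - 1) :
    cuspOrbitOf N k' = cuspOrbitOf N k := by
  rw [cuspOrbitOf_eq_iff_cuspInv_eq]
  exact cuspInv_eq_of_column_data h0 h1 hαd ht

omit [NeZero N] in
/-- `r ≡ 1 (mod N)` read in `ℤ`: `N ∣ r − 1`. [folklore] -/
theorem int_dvd_sub_one_of_modEq_one {r : ℕ} (hr1 : r ≡ 1 [MOD N]) (hr : 1 ≤ r) : (N : ℤ) ∣ (r : ℤ) - 1 := by
  have h := (Nat.modEq_iff_dvd' hr).mp hr1.symm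
  have h' := Int.natCast_dvd_natCast.mpr h
  rwa [Nat.cast_sub hr, Nat.cast_one] at h'

omit [NeZero N] in
/-- If `t ∣ r·x.num` and `t ∣ r·x.den` then `t ∣ r` (Bezout for the reduced fraction), so for a prime
`r ≡ 1 (mod N)` one gets `t² ≡ 1 (mod N)` (`t = ±1` or `±r`). [folklore] -/
theorem dvd_mul_self_sub_one_of_dvd {r : ℕ} (hr : r.Prime) (hr1 : r ≡ 1 [MOD N]) (x : ℚ) {t : ℤ}
    (h0 : t ∣ (r : ℤ) * x.num) (h1 : t ∣ (r : ℤ) * x.den) : (N : ℤ) ∣ t * t - 1 := by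
  have hcop : IsCoprime x.num (x.den : ℤ) := by
    rw [Int.isCoprime_iff_gcd_eq_one, Int.gcd, Int.natAbs_natCast]
    exact x.reduced
  obtain ⟨u, v, huv⟩ := hcop
  have htr : t ∣ (r : ℤ) := by
    have : (r : ℤ) = u * ((r : ℤ) * x.num) + v * ((r : ℤ) * x.den) := by linear_combination -(r : ℤ) * huv
    rw [this]
    exact dvd_add (dvd_mul_of_dvd_right h0 _) (dvd_mul_of_dvd_right h1 _)
  have habs : t.natAbs ∣ r := by
    have := Int.natAbs_dvd_natAbs.mpr htr
    simpa using this
  have hr1' : (N : ℤ) ∣ (r : ℤ) * r - 1 := by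
    have h' : (N : ℤ) ∣ (r : ℤ) - 1 := int_dvd_sub_one_of_modEq_one hr1 hr.one_lt.le
    have : (r : ℤ) * r - 1 = ((r : ℤ) - 1) * (r + 1) := by ring
    rw [this]
    exact h'.mul_right _
  rcases (Nat.dvd_prime hr).mp habs with h | h
  · have : t * t = 1 := by
      have := Int.natAbs_mul_self' t
      rw [← this, h]; norm_num
    rw [this, sub_self]
    exact dvd_zero _
  · have : t * t = (r : ℤ) * r := by
      have := Int.natAbs_mul_self' t
      rw [← this, h]
    rwa [this]

/-- **The cusps `(x + j)/r` and `x` are `Γ₀(N)`-equivalent for a prime `r ≡ 1 (mod N)`** (`j ∈ ℤ`): with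
`k_x`, `k_y` the Bezout matrices of first columns `(num, den)`, `[k_y ∞] = [k_x ∞]`. The unreduced fraction
`(x.num + j·x.den)/(r·x.den)` is `t·(y.num, y.den)` with `t ∣ r`. [cite: DiamondShurman2005, §3.8]
[cite: CremonaAlgorithms1997, Prop. 2.2.3] -/
theorem cuspOrbitOf_numDen_div_prime_eq {r : ℕ} (hr : r.Prime) (hr1 : r ≡ 1 [MOD N]) (x : ℚ) (j : ℤ)
    {kx ky : SL(2, ℤ)} (hkx0 : kx 0 0 = x.num) (hkx1 : kx 1 0 = x.den)
    (hky0 : ky 0 0 = ((x + j) / r).num) (hky1 : ky 1 0 = ((x + j) / r).den) :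
    cuspOrbitOf N ky = cuspOrbitOf N kx := by
  have hr0 : (r : ℚ) ≠ 0 := by exact_mod_cast hr.ne_zero
  have hd0 : ((r : ℤ) * x.den : ℤ) ≠ 0 := mul_ne_zero (by exact_mod_cast hr.ne_zero) (by exact_mod_cast x.den_ne_zero)
  have hxd : x * (x.den : ℚ) = x.num := Rat.mul_den_eq_num x
  have hy : (((x.num + j * x.den : ℤ) : ℚ) / (((r : ℤ) * x.den : ℤ) : ℚ)) = (x + j) / r := by
    rw [div_eq_div_iff (by exact_mod_cast hd0) hr0]
    push_cast
    linear_combination (-(r : ℚ)) * hxd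
  obtain ⟨t, ht0, ht1⟩ := Rat.exists_eq_mul_div_num_and_eq_mul_div_den (x.num + j * x.den) hd0
  rw [hy] at ht0 ht1
  refine cuspOrbitOf_eq_of_column_data (t := t) (α := 1) (β := j) (d := r) ?_ ?_ ?_ ?_
  · rw [hky0, hkx0, hkx1, ← ht0]; ring
  · rw [hky1, hkx1, ← ht1]
  · rw [one_mul]
    exact int_dvd_sub_one_of_modEq_one hr1 hr.one_lt.le
  · refine dvd_mul_self_sub_one_of_dvd hr hr1 x ?_ ⟨_, ht1⟩
    -- `t ∣ r·x.num`: `r·x.num = t·(r·y.num − j·y.den)`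
    refine ⟨(r : ℤ) * ((x + j) / r).num - j * ((x + j) / r).den, ?_⟩
    linear_combination (r : ℤ) * ht0 - j * ht1

/-- **The cusps `r·x` and `x` are `Γ₀(N)`-equivalent for a prime `r ≡ 1 (mod N)`.** The unreduced fraction
`(r·x.num)/x.den` is `t·(y.num, y.den)` with `t ∣ r`. [cite: DiamondShurman2005, §3.8] [cite: CremonaAlgorithms1997, Prop. 2.2.3] -/
theorem cuspOrbitOf_numDen_prime_mul_eq {r : ℕ} (hr : r.Prime) (hr1 : r ≡ 1 [MOD N]) (x : ℚ)
    {kx ky : SL(2, ℤ)} (hkx0 : kx 0 0 = x.num) (hkx1 : kx 1 0 = x.den)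
    (hky0 : ky 0 0 = ((r : ℚ) * x).num) (hky1 : ky 1 0 = ((r : ℚ) * x).den) :
    cuspOrbitOf N ky = cuspOrbitOf N kx := by
  have hd0 : ((x.den : ℤ) : ℤ) ≠ 0 := by exact_mod_cast x.den_ne_zero
  have hxd : x * (x.den : ℚ) = x.num := Rat.mul_den_eq_num x
  have hy : ((((r : ℤ) * x.num : ℤ) : ℚ) / ((x.den : ℤ) : ℚ)) = (r : ℚ) * x := by
    rw [div_eq_iff (by exact_mod_cast hd0)]
    push_cast
    linear_combination (-(r : ℚ)) * hxd
  obtain ⟨t, ht0, ht1⟩ := Rat.exists_eq_mul_div_num_and_eq_mul_div_den ((r : ℤ) * x.num) hd0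
  rw [hy] at ht0 ht1
  refine cuspOrbitOf_eq_of_column_data (t := t) (α := r) (β := 0) (d := 1) ?_ ?_ ?_ ?_
  · rw [hky0, hkx0, ← ht0]; ring
  · rw [hky1, hkx1, ← ht1]; ring
  · rw [mul_one]
    exact int_dvd_sub_one_of_modEq_one hr1 hr.one_lt.le
  · refine dvd_mul_self_sub_one_of_dvd hr hr1 x ⟨_, ht0⟩ ?_
    exact ⟨(r : ℤ) * (((r : ℚ) * x).den : ℤ), by linear_combination (r : ℤ) * ht1⟩

end Cusps

/-! ### §2 The canonical-period normalisation at any level -/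

section Period

variable {N : ℕ} [NeZero N] {I : Type*} [Fintype I] (φ : I → CuspForm (Gamma0 N) 2) (c : I → ℂ)

/-- **Same `Γ₀(N)`-cusp class ⟹ `Ψ` differs by a CYCLE value** (ANY level; Manin relation for every `φᵢ`): if
the Bezout matrices of `x`, `y` have `Γ₀(N)`-equivalent cusps then `Ψ(y) = Ψ(x) − Σ cᵢ Re⟨γ⟩_{φᵢ}` for some
`γ ∈ Γ₀(N)`. [cite: DiamondShurman2005, §3.8] [cite: CremonaAlgorithms1997, §2.2] -/
theorem exists_plusSymbol_sum_smul_eq_sub_of_cuspOrbitOf_eq (hreal : ∀ i n, (cuspCoeff (φ i) n).im = 0)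
    {x y : ℚ} {kx ky : SL(2, ℤ)} (hx0 : kx 0 0 = x.num) (hx1 : kx 1 0 = x.den) (hy0 : ky 0 0 = y.num)
    (hy1 : ky 1 0 = y.den) (horb : cuspOrbitOf N kx = cuspOrbitOf N ky) :
    ∃ γ : Gamma0 N,
      plusSymbol (∑ i, c i • φ i) y =
        plusSymbol (∑ i, c i • φ i) x - ∑ i, c i * (((cuspSymbol (φ i) γ).re : ℝ) : ℂ) := by
  obtain ⟨γ, hγ, hp⟩ := (cuspOrbitOf_eq_iff N kx ky).mp horb
  refine ⟨⟨γ, hγ⟩, ?_⟩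
  have hfix : ∀ ψ : CuspForm (Gamma0 N) 2, inftySymbol ψ (γ * ky) = inftySymbol ψ kx := by
    intro ψ
    rw [show γ * ky = kx * (kx⁻¹ * γ * ky) by group]
    exact inftySymbol_mul_of_apply_one_zero_eq_zero ψ kx _ hp
  rw [plusSymbol_sum_smul_eq φ c hreal hy0 hy1, plusSymbol_sum_smul_eq φ c hreal hx0 hx1, ← Finset.sum_sub_distrib]
  refine Finset.sum_congr rfl fun i _ ↦ ?_
  rw [← hfix (φ i), inftySymbol_mul_of_mem (φ i) hγ ky, Complex.add_re, Complex.ofReal_add, cuspSymbol_eq_inftySymbol]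
  ring

variable {φ}

/-- ★ **THE CANONICAL-PERIOD NORMALISATION for `Ψ = plusSymbol (Σ cᵢ φᵢ)` at ANY LEVEL** (`φᵢ ∈ S₂(Γ₀(N))` with
REAL coefficients, `cᵢ ∈ ℂ` arbitrary, `Ψ ≢ 0`, ONE prime `r ≡ 1 (mod N)` — so `r ∤ N` — with
`T_r (Σ cᵢ φᵢ) = a·(Σ cᵢ φᵢ)`, `a` integral and `a − r − 1` a `3`-adic unit): there is `Ω ∈ ℂ` with `Ψ(x)/Ω` integral
for every `x ∈ ℚ` and `Ψ(γ₀∞)/Ω` a UNIT for some `γ₀ ∈ Γ₀(N)`, `γ₀∞ ≠ ∞`. Gen 6's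
`…MultiStabPeriod.exists_period_integral_unit_cycle_sum_smul` VERBATIM except for step (E): the reduced symbol is
constant on `Γ₀(N)`-CUSP CLASSES (§2's first lemma), and the `r + 1` cusps `(x+j)/r`, `rx` of `T_r{∞, x}` lie in the
class of `x` because `r ≡ 1 (mod N)` (§1). [cite: Vatsal1999, §1 (1.3) display (5), (1.5)–(1.6), Remark (1.12)]
[cite: CremonaAlgorithms1997, §2.3 and §2.8] [cite: DiamondShurman2005, §3.8] -/
theorem exists_period_integral_unit_cycle_sum_smul_of_one_mod (ι : PadicAlgCl 3 ≃+* ℂ)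
    (hreal : ∀ i n, (cuspCoeff (φ i) n).im = 0)
    (hne : ∃ x : ℚ, plusSymbol (∑ i, c i • φ i) x ≠ 0)
    {r : ℕ} (hr : r.Prime) (hrM : ¬ r ∣ N) (hr1 : r ≡ 1 [MOD N]) {a : ℂ} (ha : Valued.v (ι.symm a) ≤ 1)
    (hT : (haveI : NeZero r := ⟨hr.ne_zero⟩; heckeT (Gamma0 N) 2 r (∑ i, c i • φ i)) = a • ∑ i, c i • φ i)
    (hE : Valued.v (ι.symm (a - (r + 1))) = 1) :
    ∃ Ω : ℂ, (∀ x : ℚ, Valued.v (ι.symm (plusSymbol (∑ i, c i • φ i) x / Ω)) ≤ 1) ∧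
      ∃ γ₀ : Gamma0 N, (γ₀ : SL(2, ℤ)) 1 0 ≠ 0 ∧
        Valued.v (ι.symm (plusSymbol (∑ i, c i • φ i)
          ((((γ₀ : SL(2, ℤ)) 0 0 : ℤ) : ℚ) / (((γ₀ : SL(2, ℤ)) 1 0 : ℤ) : ℚ)) / Ω)) = 1 := by
  classical
  haveI := charP_residueField
  haveI : NeZero r := ⟨hr.ne_zero⟩
  set res := IsLocalRing.residue (Valued.integer (PadicAlgCl 3)) with hres
  set G := ∑ i, c i • φ i with hG
  set Ψk : SL(2, ℤ) → ℂ := fun k ↦ ∑ i, c i * (((inftySymbol (φ i) k).re : ℝ) : ℂ) with hΨk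
  set C := Finset.univ.sup' ⟨((1 : SL(2, ℤ)) : Gamma0Coset N), Finset.mem_univ _⟩
    (fun q : Gamma0Coset N ↦ ‖ι.symm (∑ i, c i * ((((msymbol N q) (φ i)).re : ℝ) : ℂ))‖) with hC
  have hle : ∀ k : SL(2, ℤ), ‖ι.symm (Ψk k)‖ ≤ C := fun k ↦ norm_psi_le_sup φ c ι k
  obtain ⟨kS, hkS⟩ := exists_norm_psi_eq_sup φ c ι
  rw [← hC] at hkS
  change ‖ι.symm (Ψk kS)‖ = C at hkS
  have hΨk_of_ne : ∀ k : SL(2, ℤ), k 1 0 ≠ 0 → Ψk k = plusSymbol G (((k 0 0 : ℤ) : ℚ) / ((k 1 0 : ℤ) : ℚ)) := by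
    intro k hk
    simp only [hΨk, inftySymbol, if_neg hk, hG]
    rw [plusSymbol_sum_smul_eq_re φ c hreal]
  have hΨk_of_eq : ∀ k : SL(2, ℤ), k 1 0 = 0 → Ψk k = 0 := by
    intro k hk
    simp only [hΨk, inftySymbol, if_pos hk, Complex.zero_re, Complex.ofReal_zero, mul_zero, Finset.sum_const_zero]
  have hΨx : ∀ x : ℚ, ∃ k : SL(2, ℤ), k 1 0 ≠ 0 ∧ plusSymbol G x = Ψk k := by
    intro x
    obtain ⟨k, h0, hk1⟩ := exists_sl_apply_eq_num_den x
    refine ⟨k, by rw [hk1]; exact_mod_cast x.den_ne_zero, ?_⟩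
    rw [hG, plusSymbol_sum_smul_eq φ c hreal h0 hk1]
  have hC0 : 0 < C := by
    obtain ⟨x₀, hx₀⟩ := hne
    obtain ⟨k₀, -, hk₀⟩ := hΨx x₀
    have h1' : ι.symm (Ψk k₀) ≠ 0 := by
      rw [map_ne_zero_iff _ ι.symm.injective, ← hk₀]; exact hx₀
    exact (norm_pos_iff.mpr h1').trans_le (hle k₀)
  set Ω : ℂ := Ψk kS with hΩdef
  have hΩC : ‖ι.symm Ω‖ = C := hkS
  have hΩ0 : ι.symm Ω ≠ 0 := by rw [← norm_pos_iff, hΩC]; exact hC0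
  have hkS10 : kS 1 0 ≠ 0 := by
    intro h0
    apply hΩ0
    rw [hΩdef, hΨk_of_eq kS h0, map_zero]
  have hnorm : ∀ z : ℂ, ‖ι.symm (z / Ω)‖ = ‖ι.symm z‖ / C := by
    intro z; rw [map_div₀, norm_div, hΩC]
  have hint : ∀ x : ℚ, Valued.v (ι.symm (plusSymbol G x / Ω)) ≤ 1 := by
    intro x
    obtain ⟨k, -, hk⟩ := hΨx x
    rw [valuation_le_one_iff, hnorm, hk, div_le_one hC0]
    exact hle k
  refine ⟨Ω, hint, ?_⟩
  by_contra H
  push Not at H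
  have hcyc : ∀ γ : Gamma0 N, ‖ι.symm (Ψk γ / Ω)‖ < 1 := by
    intro γ
    by_cases h0 : (γ : SL(2, ℤ)) 1 0 = 0
    · rw [hΨk_of_eq _ h0, zero_div, map_zero, norm_zero]
      exact zero_lt_one
    · have hγ := H γ h0
      rw [hΨk_of_ne _ h0]
      have h1' := hint ((((γ : SL(2, ℤ)) 0 0 : ℤ) : ℚ) / (((γ : SL(2, ℤ)) 1 0 : ℤ) : ℚ))
      rw [valuation_le_one_iff] at h1'
      rw [Ne, valuation_eq_one_iff] at hγ
      exact lt_of_le_of_ne h1' hγ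
  have mX : ∀ x : ℚ, ι.symm (plusSymbol G x / Ω) ∈ Valued.integer (PadicAlgCl 3) := fun x ↦
    mem_integer_iff_norm_le_one.mpr (valuation_le_one_iff.mp (hint x))
  let ψ : ℚ → IsLocalRing.ResidueField (Valued.integer (PadicAlgCl 3)) := fun x ↦
    res ⟨ι.symm (plusSymbol G x / Ω), mX x⟩
  -- (E) `ψ` is constant on `Γ₀(N)`-cusp classes (ANY level)
  have hE' : ∀ (x y : ℚ) (kx ky : SL(2, ℤ)), kx 0 0 = x.num → kx 1 0 = x.den → ky 0 0 = y.num → ky 1 0 = y.den →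
      cuspOrbitOf N ky = cuspOrbitOf N kx → ψ y = ψ x := by
    intro x y kx ky hx0 hx1 hy0 hy1 horb
    obtain ⟨γ, hγ⟩ := exists_plusSymbol_sum_smul_eq_sub_of_cuspOrbitOf_eq φ c hreal hx0 hx1 hy0 hy1 horb.symm
    have hγ' : plusSymbol G y = plusSymbol G x - Ψk γ := by
      rw [hG, hγ, hΨk]
      simp only [cuspSymbol_eq_inftySymbol]
    have mγ : ι.symm (Ψk γ / Ω) ∈ Valued.integer (PadicAlgCl 3) := mem_integer_iff_norm_le_one.mpr (hcyc γ).le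
    have hO : (⟨ι.symm (plusSymbol G y / Ω), mX y⟩ : Valued.integer (PadicAlgCl 3)) =
        ⟨ι.symm (plusSymbol G x / Ω), mX x⟩ - ⟨ι.symm (Ψk γ / Ω), mγ⟩ := by
      apply Subtype.ext
      push_cast
      rw [← map_sub, hγ', sub_div]
    show res _ = res _
    rw [hO, map_sub, residue_mk_eq_zero_of_norm_lt_one mγ (hcyc γ), sub_zero]
  -- the Hecke translates at `r ≡ 1 (mod N)` stay in the class of `x`
  have hEdiv : ∀ (x : ℚ) (j : ℤ), ψ ((x + j) / r) = ψ x := by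
    intro x j
    obtain ⟨kx, hx0, hx1⟩ := exists_sl_apply_eq_num_den x
    obtain ⟨ky, hy0, hy1⟩ := exists_sl_apply_eq_num_den ((x + j) / r)
    exact hE' x _ kx ky hx0 hx1 hy0 hy1 (cuspOrbitOf_numDen_div_prime_eq hr hr1 x j hx0 hx1 hy0 hy1)
  have hEmul : ∀ x : ℚ, ψ ((r : ℚ) * x) = ψ x := by
    intro x
    obtain ⟨kx, hx0, hx1⟩ := exists_sl_apply_eq_num_den x
    obtain ⟨ky, hy0, hy1⟩ := exists_sl_apply_eq_num_den ((r : ℚ) * x)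
    exact hE' x _ kx ky hx0 hx1 hy0 hy1 (cuspOrbitOf_numDen_prime_mul_eq hr hr1 x hx0 hx1 hy0 hy1)
  -- (F) the Hecke relation of `G` at `r` kills `ψ`
  have ma : ι.symm a ∈ Valued.integer (PadicAlgCl 3) := mem_integer_iff_norm_le_one.mpr (valuation_le_one_iff.mp ha)
  have hunit : res ⟨ι.symm a, ma⟩ - ((r : IsLocalRing.ResidueField (Valued.integer (PadicAlgCl 3))) + 1) ≠ 0 := by
    have mE : ι.symm (a - (r + 1)) ∈ Valued.integer (PadicAlgCl 3) :=
      mem_integer_iff_norm_le_one.mpr (valuation_eq_one_iff.mp hE).le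
    have heq : (⟨ι.symm (a - (r + 1)), mE⟩ : Valued.integer (PadicAlgCl 3)) =
        ⟨ι.symm a, ma⟩ - ((r : Valued.integer (PadicAlgCl 3)) + 1) := by
      apply Subtype.ext
      push_cast
      rw [map_sub, map_add, map_natCast, map_one]
    have h : res ⟨ι.symm (a - (r + 1)), mE⟩ =
        res ⟨ι.symm a, ma⟩ - ((r : IsLocalRing.ResidueField (Valued.integer (PadicAlgCl 3))) + 1) := by
      rw [heq, map_sub res, map_add res, map_natCast res, map_one res]
    rw [← h, Ne, IsLocalRing.residue_eq_zero_iff, IsLocalRing.mem_maximalIdeal, mem_nonunits_iff, not_not,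
      Valuation.Integers.isUnit_iff_valuation_eq_one (Valuation.integer.integers _)]
    exact hE
  have hF : ∀ x : ℚ, ψ x = 0 := by
    intro x
    have hH := smul_plusSymbol_of_heckeT r hr hrM hT x
    have hO : (⟨ι.symm a, ma⟩ : Valued.integer (PadicAlgCl 3)) * ⟨ι.symm (plusSymbol G x / Ω), mX x⟩ =
        (∑ j : Fin r, ⟨ι.symm (plusSymbol G ((x + j) / r) / Ω), mX ((x + j) / r)⟩) +
          ⟨ι.symm (plusSymbol G (r * x) / Ω), mX (r * x)⟩ := by
      apply Subtype.ext
      push_cast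
      rw [← map_mul, ← map_sum, ← map_add]
      congr 1
      rw [mul_div_assoc', hG, hH, add_div, Finset.sum_div]
    have h := congrArg res hO
    rw [map_mul, map_add, map_sum] at h
    have hj : ∀ j : Fin r, res ⟨ι.symm (plusSymbol G ((x + j) / r) / Ω), mX ((x + j) / r)⟩ = ψ x := by
      intro j
      have e : (x + (j : ℚ)) = x + ((j : ℕ) : ℤ) := by push_cast; rfl
      have := hEdiv x ((j : ℕ) : ℤ)
      rw [← e] at this
      exact this
    have hrx : res ⟨ι.symm (plusSymbol G (r * x) / Ω), mX (r * x)⟩ = ψ x := hEmul x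
    simp only [hj, hrx, Finset.sum_const, Finset.card_univ, Fintype.card_fin, nsmul_eq_mul] at h
    have hψ : (res ⟨ι.symm a, ma⟩ -
        ((r : IsLocalRing.ResidueField (Valued.integer (PadicAlgCl 3))) + 1)) * ψ x = 0 := by
      rw [sub_mul, add_mul, one_mul, h, sub_self]
    exact (mul_eq_zero.mp hψ).resolve_left hunit
  set xS : ℚ := ((kS 0 0 : ℤ) : ℚ) / ((kS 1 0 : ℤ) : ℚ) with hxS
  have hΩx : plusSymbol G xS = Ω := by rw [hΩdef, hΨk_of_ne kS hkS10]
  have h1' : ψ xS = 1 := by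
    have hO : (⟨ι.symm (plusSymbol G xS / Ω), mX xS⟩ : Valued.integer (PadicAlgCl 3)) = 1 := by
      apply Subtype.ext
      push_cast
      rw [hΩx, div_self (fun h ↦ hΩ0 (by rw [h, map_zero])), map_one]
    show res _ = 1
    rw [hO, map_one]
  exact one_ne_zero (h1' ▸ hF xS)

end Period

end Summit.BirchSwinnertonDyer.BirchSwinnertonDyer.Theorems.KimAtThreeDeepLowerOffStratumLevelLoweringMultiStabPeriodAnyLevel

end
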